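import Literature.Topology.FourManifolds.SphereCircleSplitting
import Literature.Topology.FourManifolds.SchoenfliesTools
import Literature.Topology.FourManifolds.ImmersionCriterion
import Literature.Topology.FourManifolds.CappedBallLid
import HarnessLib

/-!
# The two discs of the inductive step

Topic `Literature/Topology/FourManifolds`; fact seat of Alexander's theorem
(`provefact-Literature.Topology.FourManifolds.SphereEmbedding.schoenflies_exists_ball`, Schultens
(2014), Thm. 3.2.5).  **Everything in this file is proved; no definitions, no named facts.**

"Here `α` separates `S` into two disks, `D₁`, `D₂`" (Schultens (2014), proof of Thm. 3.2.5, PDF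
p. 45).  With the sphere `f(𝕊²)` in tube normal form (it meets the tube
`{ρ ≤ 1 + 3w₀, |x₂| ≤ η₀}` in the vertical unit cylinder, `α` = the unit circle `C`), this file
produces the two closed discs as subsets of `ℝ³`: the **upper disc** `D₊` (containing the part
of the cylinder above `α`) and the **lower disc** `D₋`, with `D₊ ∪ D₋ = f(𝕊²)`, `D₊ ∩ D₋ = C`,
`D_± ∖ C` connected, and the box property of `CappedBallData.StepNF` (`D₊` lies above height
`0` in the tube, `D₋` below).

* `StepDiscs.exists_discs`.

The splitting is `SphereCircleSplitting.exists_two_discs_sphere` applied to the lift of the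
unit circle through `f`; which disc is the upper one is decided by the component structure of
the complement of the circle.

## References
* J. Schultens, *Introduction to 3-Manifolds*, GSM 151, AMS (2014), proof of Thm. 3.2.5 (PDF
  p. 45).
-/

noncomputable section

open Set Metric Filter Topology Function Module
open scoped ContDiff RealInnerProductSpace Manifold

namespace Literature.Topology.FourManifolds.StepDiscs

open CappedBallLid

/-- The vertical cylinder pieces `{ρ² = 1, a ≤ x₂, x₂ < b}`-type sets are preconnected: the set
`{ρ² = 1, x₂ ∈ I}` for a preconnected `I ⊆ ℝ` is the continuous image of `I × ℝ`. [folklore] -/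
theorem isPreconnected_wall {I : Set ℝ} (hI : IsPreconnected I) :
    IsPreconnected {x : EuclideanSpace ℝ (Fin 3) | hsq x = 1 ∧ x 2 ∈ I} := by
  set g : ℝ × ℝ → EuclideanSpace ℝ (Fin 3) := fun p =>
    Real.cos p.2 • EuclideanSpace.single 0 1 + Real.sin p.2 • EuclideanSpace.single 1 1 + p.1 • EuclideanSpace.single 2 1 with hg
  have hgc : Continuous g := by
    simp only [hg]
    exact (((Real.continuous_cos.comp continuous_snd).smul continuous_const).add
      ((Real.continuous_sin.comp continuous_snd).smul continuous_const)).add (continuous_fst.smul continuous_const)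
  have hg0 : ∀ p, g p 0 = Real.cos p.2 := fun p => by simp [hg]
  have hg1 : ∀ p, g p 1 = Real.sin p.2 := fun p => by simp [hg]
  have hg2 : ∀ p, g p 2 = p.1 := fun p => by simp [hg]
  have heq : {x : EuclideanSpace ℝ (Fin 3) | hsq x = 1 ∧ x 2 ∈ I} = g '' (I ×ˢ univ) := by
    ext x
    constructor
    · rintro ⟨h1, h2⟩
      have hcs : (x 0) ^ 2 + (x 1) ^ 2 = 1 := h1
      obtain ⟨θ, hθc, hθs⟩ : ∃ θ, Real.cos θ = x 0 ∧ Real.sin θ = x 1 := by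
        have habs : |x 0| ≤ 1 := by rw [abs_le]; constructor <;> nlinarith [sq_nonneg (x 1)]
        rcases le_or_gt 0 (x 1) with hs | hs
        · refine ⟨Real.arccos (x 0), Real.cos_arccos (abs_le.1 habs).1 (abs_le.1 habs).2, ?_⟩
          rw [Real.sin_arccos]
          have : 1 - (x 0) ^ 2 = (x 1) ^ 2 := by linarith
          rw [this, Real.sqrt_sq hs]
        · refine ⟨-Real.arccos (x 0), by rw [Real.cos_neg]; exact Real.cos_arccos (abs_le.1 habs).1 (abs_le.1 habs).2, ?_⟩
          rw [Real.sin_neg, Real.sin_arccos]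
          have : 1 - (x 0) ^ 2 = (x 1) ^ 2 := by linarith
          rw [this, Real.sqrt_sq_eq_abs, abs_of_neg hs]; ring
      refine ⟨(x 2, θ), ⟨h2, mem_univ _⟩, ?_⟩
      ext i; fin_cases i
      · exact (hg0 _).trans hθc
      · exact (hg1 _).trans hθs
      · exact hg2 _
    · rintro ⟨⟨t, θ⟩, ⟨ht, -⟩, rfl⟩
      refine ⟨?_, by rw [hg2]; exact ht⟩
      rw [hsq, hg0, hg1]; exact Real.cos_sq_add_sin_sq θ
  rw [heq]
  exact (hI.prod isPreconnected_univ).image _ hgc.continuousOn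

set_option maxHeartbeats 3200000 in
/-- **The two discs** (see the module docstring). [cite: Schultens2014, proof of Thm. 3.2.5 (PDF p. 45)] -/
theorem exists_discs {f : sphere (0 : EuclideanSpace ℝ (Fin 3)) 1 → EuclideanSpace ℝ (Fin 3)}
    (hf : Manifold.IsSmoothEmbedding (𝓡 2) 𝓘(ℝ, EuclideanSpace ℝ (Fin 3)) ∞ f)
    {w₀ η₀ : ℝ} (hw₀ : 0 < w₀) (hη₀ : 0 < η₀)
    (hwall : ∀ x : EuclideanSpace ℝ (Fin 3), hsq x ≤ (1 + 3 * w₀) ^ 2 → |x 2| ≤ η₀ → (x ∈ range f ↔ hsq x = 1)) :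
    ∃ Dup Dlow : Set (EuclideanSpace ℝ (Fin 3)),
      IsClosed Dup ∧ IsClosed Dlow ∧ Dup ∪ Dlow = range f ∧
      Dup ∩ Dlow = {x | hsq x = 1 ∧ x 2 = 0} ∧
      IsPreconnected (Dup \ {x | hsq x = 1 ∧ x 2 = 0}) ∧ IsPreconnected (Dlow \ {x | hsq x = 1 ∧ x 2 = 0}) ∧
      (∀ x ∈ Dup, hsq x ≤ (1 + 3 * w₀) ^ 2 → |x 2| ≤ η₀ → 0 ≤ x 2) ∧
      (∀ x ∈ Dlow, hsq x ≤ (1 + 3 * w₀) ^ 2 → |x 2| ≤ η₀ → x 2 ≤ 0) ∧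
      (∀ p ∈ range f, hsq p ≤ (1 + 3 * w₀) ^ 2 → |p 2| ≤ η₀ → 0 < p 2 → p ∈ Dup) ∧
      (∀ p ∈ range f, hsq p ≤ (1 + 3 * w₀) ^ 2 → |p 2| ≤ η₀ → p 2 < 0 → p ∈ Dlow) := by
  haveI : Fact (finrank ℝ (EuclideanSpace ℝ (Fin 2)) = 1 + 1) := ⟨by simp⟩
  haveI : Fact (finrank ℝ (EuclideanSpace ℝ (Fin 3)) = 2 + 1) := ⟨by simp⟩
  set C : Set (EuclideanSpace ℝ (Fin 3)) := {x | hsq x = 1 ∧ x 2 = 0} with hC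
  set v : EuclideanSpace ℝ (Fin 3) := EuclideanSpace.single 2 1 with hv
  have hfinj : Injective f := hf.isEmbedding.injective
  -- membership of wall points in the range
  have hwall_mem : ∀ x : EuclideanSpace ℝ (Fin 3), hsq x = 1 → |x 2| ≤ η₀ → x ∈ range f := fun x h1 h2 =>
    (hwall x (by rw [h1]; nlinarith) h2).2 h1
  -- §1 the unit circle as an embedded circle in the sphere
  set L : EuclideanSpace ℝ (Fin 2) → EuclideanSpace ℝ (Fin 3) := fun w =>
    (w 0) • EuclideanSpace.single 0 1 + (w 1) • EuclideanSpace.single 1 1 with hL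
  have hL0 : ∀ w, (L w) 0 = w 0 := fun w => by simp [hL]
  have hL1 : ∀ w, (L w) 1 = w 1 := fun w => by simp [hL]
  have hL2 : ∀ w, (L w) 2 = 0 := fun w => by simp [hL]
  have hLh : ∀ w, hsq (L w) = ‖w‖ ^ 2 := fun w => by
    rw [hsq, hL0, hL1, EuclideanSpace.norm_sq_eq]; simp [Fin.sum_univ_two]
  have hLlin : IsLinearMap ℝ L := ⟨fun a b => by simp only [hL, PiLp.add_apply, add_smul]; abel,
    fun c a => by simp only [hL, PiLp.smul_apply, smul_eq_mul, smul_add, smul_smul]⟩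
  set Lc : EuclideanSpace ℝ (Fin 2) →L[ℝ] EuclideanSpace ℝ (Fin 3) := LinearMap.toContinuousLinearMap (hLlin.mk' L) with hLc
  have hLc_apply : ∀ w, Lc w = L w := fun w => rfl
  have hLinj : Injective L := by
    intro a b h
    ext i; fin_cases i
    · have := congrArg (fun x : EuclideanSpace ℝ (Fin 3) => x 0) h; simpa [hL0] using this
    · have := congrArg (fun x : EuclideanSpace ℝ (Fin 3) => x 1) h; simpa [hL1] using this
  set c : sphere (0 : EuclideanSpace ℝ (Fin 2)) 1 → EuclideanSpace ℝ (Fin 3) := fun u => L u with hc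
  have hc_smooth : ContMDiff (𝓡 1) 𝓘(ℝ, EuclideanSpace ℝ (Fin 3)) ∞ c :=
    (contMDiff_iff_contDiff.2 Lc.contDiff).comp contMDiff_coe_sphere
  have hc_inj : Injective c := fun a b h => Subtype.ext (hLinj h)
  have hc_mf : ∀ u, Injective (mfderiv (𝓡 1) 𝓘(ℝ, EuclideanSpace ℝ (Fin 3)) c u) := by
    intro u
    have h1 : MDifferentiableAt (𝓡 1) 𝓘(ℝ, EuclideanSpace ℝ (Fin 2)) (Subtype.val : sphere (0 : EuclideanSpace ℝ (Fin 2)) 1 → _) u :=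
      (contMDiff_coe_sphere (m := ∞) (n := 1) u).mdifferentiableAt (by simp)
    have h2 : MDifferentiableAt 𝓘(ℝ, EuclideanSpace ℝ (Fin 2)) 𝓘(ℝ, EuclideanSpace ℝ (Fin 3)) (Lc : _ → _) (u : EuclideanSpace ℝ (Fin 2)) :=
      Lc.contMDiff.mdifferentiableAt (n := ∞) (by simp)
    have hcomp : c = (Lc : _ → _) ∘ Subtype.val := rfl
    rw [hcomp, mfderiv_comp u h2 h1]
    have hD : mfderiv 𝓘(ℝ, EuclideanSpace ℝ (Fin 2)) 𝓘(ℝ, EuclideanSpace ℝ (Fin 3)) (Lc : _ → _) (u : EuclideanSpace ℝ (Fin 2)) = Lc :=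
      ContinuousLinearMap.mfderiv_eq Lc
    rw [hD]
    exact (show Injective Lc from fun a b h => hLinj h).comp (mfderiv_coe_sphere_injective (n := 1) u)
  have hc_range : range c = C := by
    ext x
    constructor
    · rintro ⟨u, rfl⟩
      exact ⟨by rw [hc, hLh, mem_sphere_zero_iff_norm.1 u.2, one_pow], hL2 _⟩
    · rintro ⟨hx1, hx2⟩
      set w : EuclideanSpace ℝ (Fin 2) := (x 0) • EuclideanSpace.single 0 1 + (x 1) • EuclideanSpace.single 1 1 with hw
      have hw0 : w 0 = x 0 := by simp [hw]
      have hw1 : w 1 = x 1 := by simp [hw]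
      have hwn : ‖w‖ = 1 := by
        rw [EuclideanSpace.norm_eq]
        have : ∑ i : Fin 2, ‖w i‖ ^ 2 = hsq x := by simp [Fin.sum_univ_two, hw0, hw1, hsq, sq_abs]
        rw [this, hx1, Real.sqrt_one]
      refine ⟨⟨w, mem_sphere_zero_iff_norm.2 hwn⟩, ?_⟩
      ext i; fin_cases i
      · simp [hc, hL0, hw0]
      · simp [hc, hL1, hw1]
      · simp [hc, hL2, hx2]
  have hCf : C ⊆ range f := fun x hx => hwall_mem x hx.1 (by rw [hx.2, abs_zero]; exact hη₀.le)
  -- the lift `γ'` of the circle through `f`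
  haveI : Nonempty (sphere (0 : EuclideanSpace ℝ (Fin 3)) 1) := by
    obtain ⟨y, -⟩ := hCf (show EuclideanSpace.single 0 1 ∈ C from ⟨by simp [hsq], by simp⟩); exact ⟨y⟩
  set γ' : sphere (0 : EuclideanSpace ℝ (Fin 2)) 1 → sphere (0 : EuclideanSpace ℝ (Fin 3)) 1 :=
    fun u => invFun f (c u) with hγ'
  have hfγ' : ∀ u, f (γ' u) = c u := fun u => invFun_eq (hCf (by rw [← hc_range]; exact mem_range_self u))
  have hγ'c : ContMDiff (𝓡 1) (𝓡 2) ∞ γ' :=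
    SchoenfliesTools.contMDiff_of_comp_isSmoothEmbedding hf (by
      have : f ∘ γ' = c := funext hfγ'
      rw [this]; exact hc_smooth)
  have hγ'e : Manifold.IsSmoothEmbedding (𝓡 1) (𝓡 2) ∞ γ' := by
    refine isSmoothEmbedding_of_injective_of_injective_mfderiv hγ'c (by simp) (fun a b h => hc_inj (by
      rw [← hfγ' a, ← hfγ' b, h])) fun u => ?_
    refine SchoenfliesTools.injective_mfderiv_of_comp_isSmoothEmbedding hf (by
      have : f ∘ γ' = c := funext hfγ'
      rw [this]; exact hc_smooth) ?_
    have : f ∘ γ' = c := funext hfγ'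
    rw [this]; exact hc_mf u
  have hrangeγ' : f '' range γ' = C := by
    rw [← range_comp, show f ∘ γ' = c from funext hfγ', hc_range]
  have hmem_rangeγ' : ∀ y, y ∈ range γ' ↔ f y ∈ C := by
    intro y
    rw [← hrangeγ']
    exact ⟨fun h => mem_image_of_mem f h, fun ⟨y', hy', hyy⟩ => hfinj hyy ▸ hy'⟩
  -- the upper wall point and its preimage
  set pup : EuclideanSpace ℝ (Fin 3) := EuclideanSpace.single 0 1 + (η₀ / 2) • v with hpup
  have hpup_h : hsq pup = 1 := by simp [hsq, hpup, hv]
  have hpup_2 : pup 2 = η₀ / 2 := by simp [hpup, hv]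
  obtain ⟨x₀, hx₀⟩ : pup ∈ range f := hwall_mem pup hpup_h (by rw [hpup_2, abs_of_pos (by positivity)]; linarith)
  have hx₀γ : x₀ ∉ range γ' := by
    rw [hmem_rangeγ', hx₀]; rintro ⟨-, h⟩; rw [hpup_2] at h; linarith
  -- §2 the two discs in the sphere
  obtain ⟨e₁, e₂, he₁, he₂, he₁S, he₂S, hunion, hinter, hdisj, hx₀e₁, hcomp₁, hcomp₂⟩ :=
    SphereCircleSplitting.exists_two_discs_sphere hγ'e hx₀γ
  have he₁c : Continuous e₁ := he₁.contMDiff.continuous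
  have he₂c : Continuous e₂ := he₂.contMDiff.continuous
  have he₁inj : Injective e₁ := he₁.isEmbedding.injective
  have he₂inj : Injective e₂ := he₂.isEmbedding.injective
  -- closed ball = ball ∪ sphere
  have hcb : closedBall (0 : EuclideanSpace ℝ (Fin 2)) 1 = ball 0 1 ∪ sphere 0 1 := (ball_union_sphere).symm
  have he₁cb : e₁ '' closedBall 0 1 = e₁ '' ball 0 1 ∪ range γ' := by rw [hcb, image_union, he₁S]
  have he₂cb : e₂ '' closedBall 0 1 = e₂ '' ball 0 1 ∪ range γ' := by rw [hcb, image_union, he₂S]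
  have hball_compl₁ : ∀ y ∈ e₁ '' ball 0 1, y ∉ range γ' := by
    rintro _ ⟨w, hw, rfl⟩ hmem
    rw [← he₁S] at hmem
    obtain ⟨w', hw', hww⟩ := hmem
    have := he₁inj hww
    rw [this] at hw'
    rw [mem_ball_zero_iff] at hw; rw [mem_sphere_zero_iff_norm] at hw'; linarith
  have hball_compl₂ : ∀ y ∈ e₂ '' ball 0 1, y ∉ range γ' := by
    rintro _ ⟨w, hw, rfl⟩ hmem
    rw [← he₂S] at hmem
    obtain ⟨w', hw', hww⟩ := hmem
    have := he₂inj hww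
    rw [this] at hw'
    rw [mem_ball_zero_iff] at hw; rw [mem_sphere_zero_iff_norm] at hw'; linarith
  have hcompl : ∀ y, y ∉ range γ' → y ∈ e₁ '' ball 0 1 ∨ y ∈ e₂ '' ball 0 1 := by
    intro y hy
    have : y ∈ e₁ '' closedBall 0 1 ∪ e₂ '' closedBall 0 1 := by rw [hunion]; exact mem_univ y
    rw [he₁cb, he₂cb] at this
    rcases this with (h | h) | (h | h)
    · exact Or.inl h
    · exact absurd h hy
    · exact Or.inr h
    · exact absurd h hy
  -- §3 the upper and lower wall pieces
  set Wp : Set (EuclideanSpace ℝ (Fin 3)) := {x | hsq x = 1 ∧ x 2 ∈ Ioc 0 η₀} with hWp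
  set Wm : Set (EuclideanSpace ℝ (Fin 3)) := {x | hsq x = 1 ∧ x 2 ∈ Ico (-η₀) 0} with hWm
  have hWp_sub : Wp ⊆ range f := fun x hx => hwall_mem x hx.1 (abs_le.2 ⟨by linarith [hx.2.1], hx.2.2⟩)
  have hWm_sub : Wm ⊆ range f := fun x hx => hwall_mem x hx.1 (abs_le.2 ⟨hx.2.1, by linarith [hx.2.2]⟩)
  have hWp_conn : IsPreconnected Wp := isPreconnected_wall isPreconnected_Ioc
  have hWm_conn : IsPreconnected Wm := isPreconnected_wall isPreconnected_Ico
  set Up : Set (sphere (0 : EuclideanSpace ℝ (Fin 3)) 1) := f ⁻¹' Wp with hUp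
  set Um : Set (sphere (0 : EuclideanSpace ℝ (Fin 3)) 1) := f ⁻¹' Wm with hUm
  have hind : Topology.IsInducing f := hf.isEmbedding.isInducing
  have hUp_conn : IsPreconnected Up := by
    rw [← hind.isPreconnected_image, hUp, image_preimage_eq_of_subset hWp_sub]; exact hWp_conn
  have hUm_conn : IsPreconnected Um := by
    rw [← hind.isPreconnected_image, hUm, image_preimage_eq_of_subset hWm_sub]; exact hWm_conn
  have hUp_compl : Up ⊆ (range γ')ᶜ := by
    intro y hy hmem
    rw [hmem_rangeγ'] at hmem
    have h1 : (f y) 2 ∈ Ioc 0 η₀ := hy.2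
    have h2 : (f y) 2 = 0 := hmem.2
    rw [h2] at h1; exact lt_irrefl _ h1.1
  have hUm_compl : Um ⊆ (range γ')ᶜ := by
    intro y hy hmem
    rw [hmem_rangeγ'] at hmem
    have h1 : (f y) 2 ∈ Ico (-η₀) 0 := hy.2
    have h2 : (f y) 2 = 0 := hmem.2
    rw [h2] at h1; exact lt_irrefl _ h1.2
  have hx₀Up : x₀ ∈ Up := by
    show f x₀ ∈ Wp
    rw [hx₀]; exact ⟨hpup_h, by rw [hpup_2]; exact ⟨by positivity, by linarith⟩⟩
  have hUp_e₁ : Up ⊆ e₁ '' ball 0 1 := by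
    rw [← hcomp₁ x₀ hx₀e₁]
    exact hUp_conn.subset_connectedComponentIn hx₀Up hUp_compl
  -- wall points of the range near the circle lie in `Up ∪ Um` or on the circle
  have hnear : ∀ y, (1 / 2) ^ 2 < hsq (f y) → hsq (f y) < (1 + 3 * w₀) ^ 2 → |(f y) 2| < η₀ → y ∉ range γ' →
      y ∈ Up ∨ y ∈ Um := by
    intro y h1 h2 h3 hy
    have hh : hsq (f y) = 1 := (hwall (f y) h2.le h3.le).1 (mem_range_self y)
    have hz0 : (f y) 2 ≠ 0 := fun h => hy ((hmem_rangeγ' y).2 ⟨hh, h⟩)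
    rcases lt_or_gt_of_ne hz0 with hneg | hpos
    · exact Or.inr ⟨hh, by rw [abs_lt] at h3; exact ⟨h3.1.le, hneg⟩⟩
    · exact Or.inl ⟨hh, by rw [abs_lt] at h3; exact ⟨hpos, h3.2.le⟩⟩
  -- **the lower wall lies in the second disc**
  have hUm_e₂ : Um ⊆ e₂ '' ball 0 1 := by
    -- the lower wall point
    set pdn : EuclideanSpace ℝ (Fin 3) := EuclideanSpace.single 0 1 + (-(η₀ / 2)) • v with hpdn
    have hpdn_h : hsq pdn = 1 := by simp [hsq, hpdn, hv]
    have hpdn_2 : pdn 2 = -(η₀ / 2) := by simp [hpdn, hv]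
    obtain ⟨ym, hym⟩ : pdn ∈ range f := hwall_mem pdn hpdn_h (by rw [hpdn_2, abs_neg, abs_of_pos (by positivity)]; linarith)
    have hymUm : ym ∈ Um := by
      show f ym ∈ Wm
      rw [hym]; exact ⟨hpdn_h, by rw [hpdn_2]; exact ⟨by linarith, by linarith⟩⟩
    rcases hcompl ym (hUm_compl hymUm) with hy₁ | hy₂
    · -- then the whole lower wall is in the first disc: contradiction near the circle
      exfalso
      have hUm_e₁ : Um ⊆ e₁ '' ball 0 1 := by
        rw [← hcomp₁ ym hy₁]
        exact hUm_conn.subset_connectedComponentIn hymUm hUm_compl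
      -- a circle point is in the closure of the second open disc
      obtain ⟨u₀⟩ : Nonempty (sphere (0 : EuclideanSpace ℝ (Fin 2)) 1) := ⟨⟨EuclideanSpace.single 0 1, by simp⟩⟩
      set p := γ' u₀ with hp
      have hp_closure : p ∈ closure (e₂ '' ball 0 1) := by
        have h1 : p ∈ e₂ '' sphere 0 1 := by rw [he₂S]; exact mem_range_self u₀
        have h2 : e₂ '' closedBall 0 1 ⊆ closure (e₂ '' ball 0 1) := by
          rw [← closure_ball (0 : EuclideanSpace ℝ (Fin 2)) one_ne_zero]
          exact image_closure_subset_closure_image he₂c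
        obtain ⟨w, hw, hwp⟩ := h1
        rw [← hwp]; exact h2 (mem_image_of_mem _ (sphere_subset_closedBall hw))
      -- an open neighbourhood of `p` in which off-circle points are wall points
      set V : Set (EuclideanSpace ℝ (Fin 3)) := {x | (1 / 2) ^ 2 < hsq x ∧ hsq x < (1 + 3 * w₀) ^ 2 ∧ |x 2| < η₀} with hV
      have hVo : IsOpen V :=
        (isOpen_lt continuous_const (contDiff_hsq (n := ∞)).continuous).inter
          ((isOpen_lt (contDiff_hsq (n := ∞)).continuous continuous_const).inter
            (isOpen_lt (continuous_abs.comp (PiLp.continuous_apply 2 _ (2 : Fin 3))) continuous_const))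
      have hpC : f p ∈ C := (hmem_rangeγ' p).1 (mem_range_self u₀)
      have hpV : p ∈ f ⁻¹' V := by
        show f p ∈ V
        refine ⟨by rw [hpC.1]; norm_num, by rw [hpC.1]; nlinarith, by rw [hpC.2, abs_zero]; exact hη₀⟩
      have hN : f ⁻¹' V ∈ 𝓝 p := (hVo.preimage hf.contMDiff.continuous).mem_nhds hpV
      obtain ⟨q, hqN, hq₂⟩ : (f ⁻¹' V ∩ e₂ '' ball 0 1).Nonempty := mem_closure_iff_nhds.1 hp_closure _ hN
      have hqγ : q ∉ range γ' := hball_compl₂ q hq₂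
      have hqV : f q ∈ V := hqN
      have hq₁ : q ∈ e₁ '' ball 0 1 := by
        rcases hnear q hqV.1 hqV.2.1 hqV.2.2 hqγ with h | h
        · exact hUp_e₁ h
        · exact hUm_e₁ h
      exact Set.disjoint_left.1 hdisj hq₁ hq₂
    · rw [← hcomp₂ ym hy₂]
      exact hUm_conn.subset_connectedComponentIn hymUm hUm_compl
  -- §4 the discs in `ℝ³`
  set Dup : Set (EuclideanSpace ℝ (Fin 3)) := f '' (e₁ '' closedBall 0 1) with hDup
  set Dlow : Set (EuclideanSpace ℝ (Fin 3)) := f '' (e₂ '' closedBall 0 1) with hDlow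
  have hDup_c : IsCompact Dup := ((isCompact_closedBall _ _).image he₁c).image hf.contMDiff.continuous
  have hDlow_c : IsCompact Dlow := ((isCompact_closedBall _ _).image he₂c).image hf.contMDiff.continuous
  refine ⟨Dup, Dlow, hDup_c.isClosed, hDlow_c.isClosed, ?_, ?_, ?_, ?_, ?_, ?_, ?_, ?_⟩
  · rw [hDup, hDlow, ← image_union, hunion, image_univ]
  · rw [hDup, hDlow, ← image_inter hfinj, hinter, hrangeγ']
  · have : Dup \ C = f '' (e₁ '' ball 0 1) := by
      rw [hDup, ← hrangeγ', ← image_sdiff hfinj, ← he₁S, ← image_sdiff he₁inj, closedBall_sdiff_sphere]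
    rw [this]
    exact ((isConnected_ball (x := (0 : EuclideanSpace ℝ (Fin 2))) one_pos).isPreconnected.image _ he₁c.continuousOn).image _
      hf.contMDiff.continuous.continuousOn
  · have : Dlow \ C = f '' (e₂ '' ball 0 1) := by
      rw [hDlow, ← hrangeγ', ← image_sdiff hfinj, ← he₂S, ← image_sdiff he₂inj, closedBall_sdiff_sphere]
    rw [this]
    exact ((isConnected_ball (x := (0 : EuclideanSpace ℝ (Fin 2))) one_pos).isPreconnected.image _ he₂c.continuousOn).image _
      hf.contMDiff.continuous.continuousOn
  · -- box property of the upper disc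
    rintro x ⟨y, hy, rfl⟩ h1 h2
    by_contra hneg
    push Not at hneg
    have hh : hsq (f y) = 1 := (hwall (f y) h1 h2).1 (mem_range_self y)
    have hyUm : y ∈ Um := ⟨hh, ⟨(abs_le.1 h2).1, hneg⟩⟩
    have hy₂ := hUm_e₂ hyUm
    rw [he₁cb] at hy
    rcases hy with hy | hy
    · exact Set.disjoint_left.1 hdisj hy hy₂
    · exact hball_compl₂ y hy₂ hy
  · -- box property of the lower disc
    rintro x ⟨y, hy, rfl⟩ h1 h2
    by_contra hpos
    push Not at hpos
    have hh : hsq (f y) = 1 := (hwall (f y) h1 h2).1 (mem_range_self y)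
    have hyUp : y ∈ Up := ⟨hh, ⟨hpos, (abs_le.1 h2).2⟩⟩
    have hy₁ := hUp_e₁ hyUp
    rw [he₂cb] at hy
    rcases hy with hy | hy
    · exact Set.disjoint_left.1 hdisj hy₁ hy
    · exact hball_compl₁ y hy₁ hy
  · rintro p ⟨y, rfl⟩ h1 h2 hpos
    have hh : hsq (f y) = 1 := (hwall (f y) h1 h2).1 (mem_range_self y)
    have hyUp : y ∈ Up := ⟨hh, ⟨hpos, (abs_le.1 h2).2⟩⟩
    exact ⟨y, by rw [he₁cb]; exact Or.inl (hUp_e₁ hyUp), rfl⟩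
  · rintro p ⟨y, rfl⟩ h1 h2 hneg
    have hh : hsq (f y) = 1 := (hwall (f y) h1 h2).1 (mem_range_self y)
    have hyUm : y ∈ Um := ⟨hh, ⟨(abs_le.1 h2).1, hneg⟩⟩
    exact ⟨y, by rw [he₂cb]; exact Or.inl (hUm_e₂ hyUm), rfl⟩

end Literature.Topology.FourManifolds.StepDiscs
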